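import Summits.AtomisticToContinuum.HydrodynamicLimit.Theorems.OneFlightGossipEngineSuperExponentialEnergyTailsInputsToReal
import HarnessLib

/-!
# Line `Sketch` of crux `SuperExponentialEnergyTails` (stmt-AtomisticToContinuum-17701): the Gevrey-`3/2`
# moment hierarchy of the true law from the inputs (registered stub `stub_gevreyHierarchyOfInputs`, stage 2 of 2)

Support file (`--supports stmt-AtomisticToContinuum-17701`) of line Sketch, worker MI, proving the registered stub

  `stub_gevreyHierarchyOfInputs : GevreyInduction → MomentRegularity → PovznerCeiling → ChaosCeiling → RateFloor →
    VelocityMomentGevreyHierarchy ((3 : ℝ) / 2)`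

(all five hypotheses are propositions of `…SuperExponentialEnergyTailsDefsB`; the three contact inputs are
conjecture-grade and stay HYPOTHESES here).  Content:

* `integral_balance_eq`, `balance_algebra` — the pure real-analysis pieces (linearity of the interval integral on
  the balance integrand of `MomentSystem`; the linear inequality ledger + Povzner + rate floor + chaos ceiling);
* `povzner_toReal` — the Povzner ceiling read in `ℝ` once all collision sums of the window are finite;
* `balance_of_inputs` — for ONE order `k` with `C_SD ≤ k + 1`, one `N` and one window `0 ≤ s ≤ s'`: the exact
  ledger `m_{2k}(s') − m_{2k}(s) = post − pre` (`toReal_velMoment_sub_eq`), the Povzner ceiling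
  `post ≤ γ pre + (γ/2) Σ_j C(k,j) pair_j`, the chaos ceiling `pair_j ≤ ν C_G (1 + min)^q ∫ (m m + m m)` (which also
  makes `pre`, `post` finite through `preMomentSum_le_pairMomentSum_add` at orders `(k,0)`, `(0,k)`), and the rate
  floor `ν K₁ ∫ m_{2k+1} ≤ pre + ν K₂ ∫ m_{2k}` give the `balance` field of `MomentSystem` with `ν = ν_N`;
* `stub_gevreyHierarchyOfInputs` — `σ₀ := min (σ_SD, σ_CE, σ_RF, 1/2)`; for `t < T`: `E₁ := C₀ A₀`,
  `k₁ := max 2 ⌈2 C_SD⌉₊`, constants `C, A` from `GevreyInduction`; for an order `k`, `n := max k k₁` and the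
  threshold `N₀ := sup_{k' ≤ n} max (N_SD k', N_RF k', sup_{j ≤ k'} N_CE j (k' − j))`; for `N ≥ N₀` the real moments
  form a `MomentSystem t ν_N n k₁ …` and the induction bounds `m_{2k} ≤ C Aᵏ k^{3k/2} ≤ (max C 1) Aᵏ k^{3k/2}`.

No new definitions; [folklore] plumbing over DefsB, `…InputsToReal` and the prelude.
-/

noncomputable section

namespace Summit.AtomisticToContinuum.HydrodynamicLimit.Theorems.SuperExponentialEnergyTailsHierarchyOfInputs

open scoped BigOperators ENNReal
open MeasureTheory Set
open Literature.MathematicalPhysics.KineticTheory Literature.Analysis.FluidPDE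
open Summit.AtomisticToContinuum.HydrodynamicLimit.Theorems.SuperExponentialEnergyTailsLine
  (velMoment preMomentSum postMomentSum pairMomentSum collisionScale VelocityMomentGevreyHierarchy PovznerCeiling
    ChaosCeiling RateFloor MomentRegularityFor MomentRegularity MomentSystem GevreyInduction stub_collisionScale_pos)

/-! ## Pure real-analysis pieces of the balance -/

/-- Linearity of the interval integral on the balance integrand of `MomentSystem` (continuous moments).
[folklore] -/
theorem integral_balance_eq {m : ℕ → ℝ → ℝ} {s s' : ℝ} (hss' : s ≤ s')
    (hm : ∀ p, ContinuousOn (m p) (Icc s s')) (q : ℕ) (K₁ K₂ CG γ : ℝ) (k : ℕ) :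
    ∫ r in s..s', (γ / 2 * ∑ j ∈ Finset.Ioo 0 k, (k.choose j : ℝ) * (CG * (1 + (min j (k - j) : ℝ)) ^ q) *
          (m (2 * j + 1) r * m (2 * (k - j)) r + m (2 * j) r * m (2 * (k - j) + 1) r)
        - (1 - γ) * (K₁ * m (2 * k + 1) r - K₂ * m (2 * k) r))
      = γ / 2 * ∑ j ∈ Finset.Ioo 0 k, (k.choose j : ℝ) * (CG * (1 + (min j (k - j) : ℝ)) ^ q) *
          (∫ r in s..s', (m (2 * j + 1) r * m (2 * (k - j)) r + m (2 * j) r * m (2 * (k - j) + 1) r))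
        - (1 - γ) * (K₁ * (∫ r in s..s', m (2 * k + 1) r) - K₂ * (∫ r in s..s', m (2 * k) r)) := by
  have hI : ∀ {F : ℝ → ℝ}, ContinuousOn F (Icc s s') → IntervalIntegrable F volume s s' :=
    fun h => h.intervalIntegrable_of_Icc hss'
  have hf : ∀ j : ℕ, ContinuousOn
      (fun r => m (2 * j + 1) r * m (2 * (k - j)) r + m (2 * j) r * m (2 * (k - j) + 1) r) (Icc s s') :=
    fun j => ((hm _).mul (hm _)).add ((hm _).mul (hm _))
  have hfc : ∀ j : ℕ, ContinuousOn (fun r => (k.choose j : ℝ) * (CG * (1 + (min j (k - j) : ℝ)) ^ q) *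
      (m (2 * j + 1) r * m (2 * (k - j)) r + m (2 * j) r * m (2 * (k - j) + 1) r)) (Icc s s') :=
    fun j => continuousOn_const.mul (hf j)
  have hA : ContinuousOn (fun r => γ / 2 * ∑ j ∈ Finset.Ioo 0 k, (k.choose j : ℝ) *
      (CG * (1 + (min j (k - j) : ℝ)) ^ q) *
        (m (2 * j + 1) r * m (2 * (k - j)) r + m (2 * j) r * m (2 * (k - j) + 1) r)) (Icc s s') :=
    continuousOn_const.mul (continuousOn_finsetSum _ fun j _ => hfc j)
  have hB : ContinuousOn (fun r => (1 - γ) * (K₁ * m (2 * k + 1) r - K₂ * m (2 * k) r)) (Icc s s') :=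
    continuousOn_const.mul ((continuousOn_const.mul (hm _)).sub (continuousOn_const.mul (hm _)))
  have hK₁ : ContinuousOn (fun r => K₁ * m (2 * k + 1) r) (Icc s s') := continuousOn_const.mul (hm _)
  have hK₂ : ContinuousOn (fun r => K₂ * m (2 * k) r) (Icc s s') := continuousOn_const.mul (hm _)
  have h1 : ∫ r in s..s', (K₁ * m (2 * k + 1) r - K₂ * m (2 * k) r) =
      K₁ * (∫ r in s..s', m (2 * k + 1) r) - K₂ * (∫ r in s..s', m (2 * k) r) := by
    rw [intervalIntegral.integral_sub (hI hK₁) (hI hK₂), intervalIntegral.integral_const_mul,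
      intervalIntegral.integral_const_mul]
  have h2 : ∫ r in s..s', ∑ j ∈ Finset.Ioo 0 k, (k.choose j : ℝ) * (CG * (1 + (min j (k - j) : ℝ)) ^ q) *
        (m (2 * j + 1) r * m (2 * (k - j)) r + m (2 * j) r * m (2 * (k - j) + 1) r) =
      ∑ j ∈ Finset.Ioo 0 k, (k.choose j : ℝ) * (CG * (1 + (min j (k - j) : ℝ)) ^ q) *
        (∫ r in s..s', (m (2 * j + 1) r * m (2 * (k - j)) r + m (2 * j) r * m (2 * (k - j) + 1) r)) := by
    rw [intervalIntegral.integral_finsetSum fun j _ => hI (hfc j)]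
    exact Finset.sum_congr rfl fun j _ => intervalIntegral.integral_const_mul _ _
  rw [intervalIntegral.integral_sub (hI hA) (hI hB), intervalIntegral.integral_const_mul, h2,
    intervalIntegral.integral_const_mul, h1]

/-- The linear-inequality core of the balance: ledger + Povzner + rate floor + chaos ceiling. [folklore] -/
theorem balance_algebra {ν γ K₁ K₂ J₁ J₀ pre post S S' d : ℝ} (hL : d = post - pre)
    (hP : post ≤ γ * pre + γ / 2 * S) (hγ : 0 ≤ γ) (hγ1 : γ ≤ 1) (hRF : ν * K₁ * J₁ ≤ pre + ν * K₂ * J₀)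
    (hS : S ≤ S') : d ≤ -(1 - γ) * (ν * K₁ * J₁ - ν * K₂ * J₀) + γ / 2 * S' := by
  have e1 : (1 - γ) * (ν * K₁ * J₁) ≤ (1 - γ) * (pre + ν * K₂ * J₀) :=
    mul_le_mul_of_nonneg_left hRF (sub_nonneg.2 hγ1)
  have e2 : γ / 2 * S ≤ γ / 2 * S' := mul_le_mul_of_nonneg_left hS (by positivity)
  nlinarith [e1, e2]

variable {σ : ℝ} {a₀ θ₀ : T3 → ℝ} {u₀ : T3 → V3} {N : ℕ}
  {Φ : HardSphereFlow (Torus.geometry (Fin 3)) (hsDiameter σ N) (N + 1)}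

/-- The Povzner ceiling read in `ℝ` (all collision sums of the window finite). [folklore] -/
theorem povzner_toReal {k : ℕ} {γ : ℝ} (hγ : 0 ≤ γ) {s s' : ℝ}
    (hpre : preMomentSum Φ (localGibbsLaw σ a₀ u₀ θ₀ N Φ) (2 * k) s s' ≠ ⊤)
    (hpair : ∀ j ∈ Finset.Ioo 0 k,
      pairMomentSum Φ (localGibbsLaw σ a₀ u₀ θ₀ N Φ) (2 * j) (2 * (k - j)) s s' ≠ ⊤)
    (h : postMomentSum Φ (localGibbsLaw σ a₀ u₀ θ₀ N Φ) (2 * k) s s' ≤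
      ENNReal.ofReal γ * preMomentSum Φ (localGibbsLaw σ a₀ u₀ θ₀ N Φ) (2 * k) s s' +
        ENNReal.ofReal (γ / 2) * ∑ j ∈ Finset.Ioo 0 k, (k.choose j : ℝ≥0∞) *
          pairMomentSum Φ (localGibbsLaw σ a₀ u₀ θ₀ N Φ) (2 * j) (2 * (k - j)) s s') :
    (postMomentSum Φ (localGibbsLaw σ a₀ u₀ θ₀ N Φ) (2 * k) s s').toReal ≤
      γ * (preMomentSum Φ (localGibbsLaw σ a₀ u₀ θ₀ N Φ) (2 * k) s s').toReal +
        γ / 2 * ∑ j ∈ Finset.Ioo 0 k, (k.choose j : ℝ) *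
          (pairMomentSum Φ (localGibbsLaw σ a₀ u₀ θ₀ N Φ) (2 * j) (2 * (k - j)) s s').toReal := by
  have hfin : ∀ j ∈ Finset.Ioo 0 k, (k.choose j : ℝ≥0∞) *
      pairMomentSum Φ (localGibbsLaw σ a₀ u₀ θ₀ N Φ) (2 * j) (2 * (k - j)) s s' ≠ ⊤ :=
    fun j hj => ENNReal.mul_ne_top (ENNReal.natCast_ne_top _) (hpair j hj)
  have hsum : ∑ j ∈ Finset.Ioo 0 k, (k.choose j : ℝ≥0∞) *
      pairMomentSum Φ (localGibbsLaw σ a₀ u₀ θ₀ N Φ) (2 * j) (2 * (k - j)) s s' ≠ ⊤ :=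
    ENNReal.sum_ne_top.2 hfin
  have hrhs : ENNReal.ofReal γ * preMomentSum Φ (localGibbsLaw σ a₀ u₀ θ₀ N Φ) (2 * k) s s' +
      ENNReal.ofReal (γ / 2) * ∑ j ∈ Finset.Ioo 0 k, (k.choose j : ℝ≥0∞) *
        pairMomentSum Φ (localGibbsLaw σ a₀ u₀ θ₀ N Φ) (2 * j) (2 * (k - j)) s s' ≠ ⊤ :=
    ENNReal.add_ne_top.2 ⟨ENNReal.mul_ne_top ENNReal.ofReal_ne_top hpre,
      ENNReal.mul_ne_top ENNReal.ofReal_ne_top hsum⟩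
  have h' := ENNReal.toReal_mono hrhs h
  rw [ENNReal.toReal_add (ENNReal.mul_ne_top ENNReal.ofReal_ne_top hpre)
      (ENNReal.mul_ne_top ENNReal.ofReal_ne_top hsum), ENNReal.toReal_mul, ENNReal.toReal_mul,
    ENNReal.toReal_ofReal hγ, ENNReal.toReal_ofReal (by positivity), ENNReal.toReal_sum hfin] at h'
  simpa only [ENNReal.toReal_mul, ENNReal.toReal_natCast] using h'

/-! ## The Povzner balance of one order under the true law -/

/-- **The balance of order `k` on the window `(s, s']`** for the real moments of the local Gibbs law transported
by the flow, from the exact ledger (`MomentRegularityFor.ledger`), the Povzner ceiling at order `k`, the chaos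
ceiling at the orders `(j, l)` with `j + l = k` and the rate floor at order `k` (all at this `N` and this window):
exactly the `balance` field of `MomentSystem` with `ν = collisionScale σ N`. [folklore] -/
theorem balance_of_inputs (hReg : MomentRegularityFor σ a₀ u₀ θ₀) (hσ : 0 < σ) (hσ2 : σ < 1 / 2) {q : ℕ}
    {K₁ K₂ CG CSD : ℝ} (hK₁ : 0 ≤ K₁) (hK₂ : 0 ≤ K₂) (hCG : 0 ≤ CG) (hCSD : 0 ≤ CSD) {k : ℕ}
    (hk : CSD ≤ (k : ℝ) + 1) {s s' : ℝ} (hs : 0 ≤ s) (hss' : s ≤ s')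
    (hSD : postMomentSum Φ (localGibbsLaw σ a₀ u₀ θ₀ N Φ) (2 * k) s s' ≤
      ENNReal.ofReal (CSD / ((k : ℝ) + 1)) * preMomentSum Φ (localGibbsLaw σ a₀ u₀ θ₀ N Φ) (2 * k) s s' +
        ENNReal.ofReal (CSD / ((k : ℝ) + 1) / 2) *
          ∑ j ∈ Finset.Ioo 0 k, (k.choose j : ℝ≥0∞) *
            pairMomentSum Φ (localGibbsLaw σ a₀ u₀ θ₀ N Φ) (2 * j) (2 * (k - j)) s s')
    (hCE : ∀ j l : ℕ, j + l = k → pairMomentSum Φ (localGibbsLaw σ a₀ u₀ θ₀ N Φ) (2 * j) (2 * l) s s' ≤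
      ENNReal.ofReal (collisionScale σ N * CG * (1 + (min j l : ℝ)) ^ q) *
        ∫⁻ r in Ioc s s', (velMoment Φ (localGibbsLaw σ a₀ u₀ θ₀ N Φ) (2 * j + 1) r *
            velMoment Φ (localGibbsLaw σ a₀ u₀ θ₀ N Φ) (2 * l) r +
          velMoment Φ (localGibbsLaw σ a₀ u₀ θ₀ N Φ) (2 * j) r *
            velMoment Φ (localGibbsLaw σ a₀ u₀ θ₀ N Φ) (2 * l + 1) r))
    (hRF : ENNReal.ofReal (collisionScale σ N * K₁) *
        ∫⁻ r in Ioc s s', velMoment Φ (localGibbsLaw σ a₀ u₀ θ₀ N Φ) (2 * k + 1) r ≤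
      preMomentSum Φ (localGibbsLaw σ a₀ u₀ θ₀ N Φ) (2 * k) s s' +
        ENNReal.ofReal (collisionScale σ N * K₂) *
          ∫⁻ r in Ioc s s', velMoment Φ (localGibbsLaw σ a₀ u₀ θ₀ N Φ) (2 * k) r) :
    (velMoment Φ (localGibbsLaw σ a₀ u₀ θ₀ N Φ) (2 * k) s').toReal -
        (velMoment Φ (localGibbsLaw σ a₀ u₀ θ₀ N Φ) (2 * k) s).toReal ≤
      collisionScale σ N * ∫ r in s..s',
        (CSD / ((k : ℝ) + 1) / 2 *
            ∑ j ∈ Finset.Ioo 0 k, (k.choose j : ℝ) * (CG * (1 + (min j (k - j) : ℝ)) ^ q) *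
              ((velMoment Φ (localGibbsLaw σ a₀ u₀ θ₀ N Φ) (2 * j + 1) r).toReal *
                  (velMoment Φ (localGibbsLaw σ a₀ u₀ θ₀ N Φ) (2 * (k - j)) r).toReal +
                (velMoment Φ (localGibbsLaw σ a₀ u₀ θ₀ N Φ) (2 * j) r).toReal *
                  (velMoment Φ (localGibbsLaw σ a₀ u₀ θ₀ N Φ) (2 * (k - j) + 1) r).toReal)
          - (1 - CSD / ((k : ℝ) + 1)) *
            (K₁ * (velMoment Φ (localGibbsLaw σ a₀ u₀ θ₀ N Φ) (2 * k + 1) r).toReal -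
              K₂ * (velMoment Φ (localGibbsLaw σ a₀ u₀ θ₀ N Φ) (2 * k) r).toReal)) := by
  set ν := collisionScale σ N with hνdef
  have hν : 0 < ν := stub_collisionScale_pos σ N hσ
  set γ := CSD / ((k : ℝ) + 1) with hγdef
  have hk0 : (0 : ℝ) < (k : ℝ) + 1 := by positivity
  have hγ0 : 0 ≤ γ := div_nonneg hCSD hk0.le
  have hγ1 : γ ≤ 1 := (div_le_one hk0).2 hk
  -- the interval integrals of the chaos ceiling, kept opaque
  obtain ⟨I, hI⟩ : ∃ I : ℕ → ℕ → ℝ, ∀ j l, I j l = ∫ r in s..s',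
      ((velMoment Φ (localGibbsLaw σ a₀ u₀ θ₀ N Φ) (2 * j + 1) r).toReal *
          (velMoment Φ (localGibbsLaw σ a₀ u₀ θ₀ N Φ) (2 * l) r).toReal +
        (velMoment Φ (localGibbsLaw σ a₀ u₀ θ₀ N Φ) (2 * j) r).toReal *
          (velMoment Φ (localGibbsLaw σ a₀ u₀ θ₀ N Φ) (2 * l + 1) r).toReal) := ⟨_, fun _ _ => rfl⟩
  have hI0 : ∀ j l, 0 ≤ I j l := fun j l => by
    rw [hI]
    exact intervalIntegral.integral_nonneg hss' fun r _ => by positivity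
  have hpair : ∀ j l : ℕ, j + l = k → pairMomentSum Φ (localGibbsLaw σ a₀ u₀ θ₀ N Φ) (2 * j) (2 * l) s s' ≤
      ENNReal.ofReal (ν * CG * (1 + (min j l : ℝ)) ^ q * I j l) := fun j l hjl => by
    rw [hI]
    exact pairMomentSum_le_ofReal hReg hs hss' (by positivity) (hCE j l hjl)
  have hpair_ne : ∀ j l : ℕ, j + l = k →
      pairMomentSum Φ (localGibbsLaw σ a₀ u₀ θ₀ N Φ) (2 * j) (2 * l) s s' ≠ ⊤ :=
    fun j l hjl => ne_top_of_le_ne_top ENNReal.ofReal_ne_top (hpair j l hjl)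
  have hpre : preMomentSum Φ (localGibbsLaw σ a₀ u₀ θ₀ N Φ) (2 * k) s s' ≠ ⊤ := by
    refine preMomentSum_ne_top hσ.le hσ2 ?_ ?_
    · simpa only [mul_zero] using hpair_ne k 0 (add_zero k)
    · simpa only [mul_zero] using hpair_ne 0 k (zero_add k)
  have hL := toReal_velMoment_sub_eq hReg (p := 2 * k) hs hss' hpre
  have hP := povzner_toReal hγ0 hpre
    (fun j hj => hpair_ne j (k - j) (Nat.add_sub_of_le (Finset.mem_Ioo.1 hj).2.le)) hSD
  have hF := rateFloor_toReal hReg hs hss' (by positivity : 0 ≤ ν * K₁) (by positivity : 0 ≤ ν * K₂) hpre hRF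
  have hS : ∑ j ∈ Finset.Ioo 0 k, (k.choose j : ℝ) *
        (pairMomentSum Φ (localGibbsLaw σ a₀ u₀ θ₀ N Φ) (2 * j) (2 * (k - j)) s s').toReal ≤
      ∑ j ∈ Finset.Ioo 0 k, (k.choose j : ℝ) * (ν * CG * (1 + (min j (k - j) : ℝ)) ^ q * I j (k - j)) := by
    refine Finset.sum_le_sum fun j hj => mul_le_mul_of_nonneg_left ?_ (Nat.cast_nonneg _)
    have hjk : j ≤ k := (Finset.mem_Ioo.1 hj).2.le
    have h := ENNReal.toReal_le_of_le_ofReal (mul_nonneg (by positivity) (hI0 j (k - j)))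
      (hpair j (k - j) (Nat.add_sub_of_le hjk))
    rwa [Nat.cast_sub hjk] at h
  have key := balance_algebra hL hP hγ0 hγ1 hF hS
  have hsum : γ / 2 * ∑ j ∈ Finset.Ioo 0 k, (k.choose j : ℝ) *
        (ν * CG * (1 + (min j (k - j) : ℝ)) ^ q * I j (k - j)) =
      ν * (γ / 2 * ∑ j ∈ Finset.Ioo 0 k, (k.choose j : ℝ) * (CG * (1 + (min j (k - j) : ℝ)) ^ q) *
        I j (k - j)) := by
    rw [Finset.mul_sum, Finset.mul_sum, Finset.mul_sum]
    exact Finset.sum_congr rfl fun j _ => by ring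
  rw [integral_balance_eq hss' (fun p => continuousOn_toReal_velMoment_Icc hReg p hs s') q K₁ K₂ CG γ k]
  simp only [← hI]
  linarith [key, hsum]

/-! ## The hierarchy from the inputs -/

/-- **Stub MI of line Sketch (registered): the Gevrey-`3/2` moment hierarchy of the true law from the inputs.**
Given the abstract induction, the `N`-side regularity of the moments, and the three true-law contact inputs, for
`σ < σ₀ := min (σ_SD, σ_CE, σ_RF, 1/2)` and `t < T`: with `E₁ := C₀ A₀`, `k₁ := max 2 ⌈2 C_SD⌉₊` and the constants
`C, A` of `GevreyInduction`, for every order `k` and `N` beyond the thresholds of the three inputs at all orders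
`≤ max k k₁` (a finite `Finset.sup`), the real moments `p s ↦ (velMoment (Φ N) λ_N p s).toReal` form a
`MomentSystem t ν_N (max k k₁) k₁ …` (`balance_of_inputs` + the conversion lemmas of `…InputsToReal`), whence
`M_{2k}(N, s) ≤ ofReal (max C 1 · Aᵏ · k^{3k/2})` on `[0, t]`. [folklore] -/
theorem stub_gevreyHierarchyOfInputs : GevreyInduction → MomentRegularity → PovznerCeiling → ChaosCeiling → RateFloor → VelocityMomentGevreyHierarchy ((3 : ℝ) / 2) := by
  intro hGI hMR hSD hCE hRF a₀ θ₀ u₀ ha hθ hu ha0 hθ0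
  obtain ⟨σ₁, hσ₁, HSD⟩ := hSD a₀ θ₀ u₀ ha hθ hu ha0 hθ0
  obtain ⟨σ₂, hσ₂, HCE⟩ := hCE a₀ θ₀ u₀ ha hθ hu ha0 hθ0
  obtain ⟨σ₃, hσ₃, HRF⟩ := hRF a₀ θ₀ u₀ ha hθ hu ha0 hθ0
  refine ⟨min (min σ₁ σ₂) (min σ₃ (1 / 2)), lt_min (lt_min hσ₁ hσ₂) (lt_min hσ₃ one_half_pos), ?_⟩
  intro σ hσ hσ0 T ρ θ u hE Φ hLLN t ht
  obtain ⟨⟨hσ1, hσ2⟩, hσ3, hσh⟩ : (σ < σ₁ ∧ σ < σ₂) ∧ σ < σ₃ ∧ σ < 1 / 2 := by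
    simpa only [lt_min_iff] using hσ0
  have hReg : MomentRegularityFor σ a₀ u₀ θ₀ := hMR a₀ θ₀ u₀ ha hθ hu ha0 hθ0 σ hσ hσh
  obtain ⟨CSD, hCSD, HSDk⟩ := HSD σ hσ hσ1 T ρ θ u hE Φ hLLN t ht
  obtain ⟨CG, hCG, q, HCEjl⟩ := HCE σ hσ hσ2 T ρ θ u hE Φ hLLN t ht
  obtain ⟨K₁, hK₁, K₂, hK₂, HRFk⟩ := HRF σ hσ hσ3 T ρ θ u hE Φ hLLN t ht
  obtain ⟨C₀, hC₀, A₀, hA₀, Hinit⟩ := hReg.initial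
  choose NSD hNSD using HSDk
  choose NRF hNRF using HRFk
  choose NCE hNCE using HCEjl
  -- the order from which the Povzner constant is at most `1/2`
  obtain ⟨k₁, hk₁2, hk₁C⟩ : ∃ k₁ : ℕ, 2 ≤ k₁ ∧ 2 * CSD ≤ (k₁ : ℝ) + 1 :=
    ⟨max 2 ⌈2 * CSD⌉₊, le_max_left _ _, (Nat.le_ceil _).trans
      ((Nat.cast_le.2 (le_max_right _ _)).trans (le_add_of_nonneg_right zero_le_one))⟩
  obtain ⟨C, hC, A, hA, HGI⟩ :=
    hGI k₁ q K₁ K₂ CG CSD (C₀ * A₀) C₀ A₀ hk₁2 hK₁ hK₂ hCG hCSD hk₁C (by positivity) hC₀ hA₀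
  refine ⟨A, hA, max C 1, lt_max_of_lt_right one_pos, fun k => ?_⟩
  -- thresholds in `N` for all orders up to `n := max k k₁`
  let thr : ℕ → ℕ := fun k' => max (max (if h : 1 ≤ k' then NSD k' h else 0) (if h : 1 ≤ k' then NRF k' h else 0))
    ((Finset.range (k' + 1)).sup fun j => NCE j (k' - j))
  refine ⟨(Finset.range (max k k₁ + 1)).sup thr, fun N hN s hs => ?_⟩
  have hthr : ∀ k', k' ≤ max k k₁ → thr k' ≤ N := fun k' hk' =>
    (Finset.le_sup (f := thr) (Finset.mem_range.2 (Nat.lt_succ_of_le hk'))).trans hN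
  have hMS : MomentSystem t (collisionScale σ N) (max k k₁) k₁ q K₁ K₂ CG CSD (C₀ * A₀) C₀ A₀
      (fun p r => (velMoment (Φ N) (localGibbsLaw σ a₀ u₀ θ₀ N (Φ N)) p r).toReal) := by
    refine ⟨fun p r _ => ENNReal.toReal_nonneg, fun r _ => (toReal_velMoment_zero hReg r).le, fun r _ => ?_,
      fun p => continuousOn_toReal_velMoment hReg p t,
      fun p₀ p p₁ h₀ h₁ r _ => toReal_velMoment_lyapunov hReg p₀ p p₁ h₀ h₁ r,
      fun k' => toReal_velMoment_initial_le hC₀.le hA₀.le k' (Hinit N (Φ N) k'),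
      fun k' hk₁' hk'n s₁ s₂ hs₁ hs₁₂ hs₂t => ?_⟩
    · -- energy
      refine toReal_velMoment_two_le hReg (by positivity) ?_ r
      have h := Hinit N (Φ N) 1
      rwa [mul_one, pow_one, Nat.factorial_one, Nat.cast_one, mul_one] at h
    · -- balance of order `k'`
      have hk'1 : 1 ≤ k' := le_trans (by norm_num) (hk₁2.trans hk₁')
      have hT := hthr k' hk'n
      have hNSD' : NSD k' hk'1 ≤ N := by
        have h : (if h : 1 ≤ k' then NSD k' h else 0) ≤ thr k' := (le_max_left _ _).trans (le_max_left _ _)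
        rw [dif_pos hk'1] at h
        exact h.trans hT
      have hNRF' : NRF k' hk'1 ≤ N := by
        have h : (if h : 1 ≤ k' then NRF k' h else 0) ≤ thr k' := (le_max_right _ _).trans (le_max_left _ _)
        rw [dif_pos hk'1] at h
        exact h.trans hT
      have hNCE' : ∀ j l : ℕ, j + l = k' → NCE j l ≤ N := by
        intro j l hjl
        obtain rfl : l = k' - j := by omega
        have hj : j ∈ Finset.range (k' + 1) := Finset.mem_range.2 (by omega)
        exact ((Finset.le_sup (f := fun j => NCE j (k' - j)) hj).trans (le_max_right _ _)).trans hT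
      have hCSDk : CSD ≤ (k' : ℝ) + 1 := by
        have h : (k₁ : ℝ) ≤ k' := by exact_mod_cast hk₁'
        linarith
      exact balance_of_inputs hReg hσ hσh hK₁.le hK₂ hCG.le hCSD.le hCSDk hs₁ hs₁₂
        (hNSD k' hk'1 N hNSD' s₁ s₂ hs₁ hs₁₂ hs₂t)
        (fun j l hjl => hNCE j l N (hNCE' j l hjl) s₁ s₂ hs₁ hs₁₂ hs₂t)
        (hNRF k' hk'1 N hNRF' s₁ s₂ hs₁ hs₁₂ hs₂t)
  have hb := HGI t (collisionScale σ N) (max k k₁) _ (stub_collisionScale_pos σ N hσ) (le_max_right _ _) hMS k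
    (le_max_left _ _) s hs
  rw [velMoment_eq_ofReal hReg]
  refine ENNReal.ofReal_le_ofReal (hb.trans ?_)
  exact mul_le_mul_of_nonneg_right (mul_le_mul_of_nonneg_right (le_max_left _ _) (by positivity))
    (by positivity)

end Summit.AtomisticToContinuum.HydrodynamicLimit.Theorems.SuperExponentialEnergyTailsHierarchyOfInputs

end
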